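import Summits.BirchSwinnertonDyer.BirchSwinnertonDyer.Theorems.EisensteinPrimesMazurMCOnCellBTowerRouteT
import Summits.BirchSwinnertonDyer.BirchSwinnertonDyer.Theorems.EisensteinPrimesMazurTwinFamily
import Summits.BirchSwinnertonDyer.Rank1Residual.X2.GreenbergVatsalStrictSelmerMultiplicative
import Summits.BirchSwinnertonDyer.Rank1Residual.Additive.ZpTowerLayerRootsOfUnity
import Literature.NumberTheory.EllipticCurves.NeronComponentIndexSplitProofs
import Literature.NumberTheory.EllipticCurves.LocalTorsionMultiplicativeProofs
import HarnessLib

/-!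
# Crux `MazurMCOnCellB` (stmt-BirchSwinnertonDyer-19033), line `mudescent`: route T at the étale end of a
# MAZUR TWIN-FAMILY pair BY NAME — the census rows of the tower budget read off `MazurTwinFamilyAt W p q`
# (stub `stub_lambdaCount_offLocus`; LEAD seat bsd-line-x2-p1, D-0154 row 5; helper; THEOREMS ONLY)

HONEST FRAMING (cell `bsd-eis`; nothing here proves BSD or a main conjecture for any class; 0 cells
move): THEOREMS ONLY — no definition, no named fact, nothing asserted about any particular curve,
closes nothing. THEOREM B′ (lam-a MEMO-10 §2, aside stmt-…-24278) is a result ON PAPER; its value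
congruence `hval` is a HYPOTHESIS below, as are the named PUBLISHED facts.

WHAT. `Theorems/EisensteinPrimesMazurMCOnCellBTowerRouteT.lean` (p609840) closes route T at the étale
end of a split Eisenstein pair with rational `p`-torsion from THEOREM B's congruence over a raising set
`S`, the TOWER budget over census Tamagawa rows `S′`, and the parity datum `#S` odd, under the
arithmetic side condition `Σ_{ℓ∈S} s_ℓ ≤ Σ_{v∈S′} p^{min(n,m_v)}`. On the MAZUR TWIN FAMILY
(`EisensteinPrimesMazurTwinFamily.MazurTwinFamilyAt W p q`, p589499: squarefree `N`, Eisenstein prime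
`q`, étale end, `E[p]` ramified exactly at `q` — hypothesis (Ram_q): `p ∣ v_ℓ(Δ)` at every other bad
`ℓ ≠ p`) the rows are CANONICAL: `S = splitPrimesOutside W p q` (the split primes `ℓ ∉ {p, q}`),
`S′ =` the places over `S`, `m_v = v_p(ℓ^{p−1} − 1) − 1` (so `p^{m_v} = s_ℓ`), `p ∣ c_v` because
`c_ℓ = v_ℓ(Δ_min)` at a split place (Kodaira–Néron, tree theorem) and (Ram_q); taking
`n = max m_v` the side condition is an identity. This file does that bookkeeping:

* `X2.mazurMainConjectureAt_etaleEnd_twinFamily_of_valueCongr_unit` — `MazurTwinFamilyAt W p q`,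
  `p` multiplicative, `v_p(#E(ℚ)_tors) = 1`, `r_an = 0`, THEOREM B's value congruence for the datum
  `(f, ϖ, L, G)` over `S = splitPrimesOutside W p q` with a unit `U` and unit constant `c`, the parity
  datum `#S` odd (sign of the functional equation; lam-a g13's PARITY LEMMA discharges it), and the
  named facts (`hWu`, `hpar`, `h415`, `h310`, `hGZK`, Poitou–Tate / Euler–Poincaré over every layer
  `ℚ_n`) ⇒ `X2.MazurMainConjectureAt W p`. No «all `s_ℓ = 1`» restriction.

References: [GreenbergLNM1716] Prop. 3.10, Prop. 4.15 (ii), §5 pp. 114–118, p. 137;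
[SilvermanATAEC1994] Cor. IV.9.2(d); [Wuthrich2014] Thm. 16; [Mazur1977] III Cor. (8.5);
[PollackWake2025] Thm. 5.12 (1); [GreenbergVatsal2000] §1 (9)–(10), §2 p. 28;
HOME/lam-a-g10/lam-a-MEMO-10.md §2, §5.
-/

set_option autoImplicit false
-- `Summit.BirchSwinnertonDyer.BirchSwinnertonDyer.…`: the summit and its single sub-problem share a name (D-0017 layout).
set_option linter.dupNamespace false

noncomputable section

open scoped Classical MatrixGroups ModularForm

open PowerSeries CongruenceSubgroup WeierstrassCurve NumberField IsDedekindDomain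
  Literature.NumberTheory.EllipticCurves
  Literature.NumberTheory.EllipticCurves.ModularForms
  Literature.NumberTheory.EllipticCurves.Rank1Residual
  Literature.NumberTheory.EllipticCurves.GreenbergVatsal2000
  Literature.NumberTheory.EllipticCurves.Wuthrich2014
  Literature.NumberTheory.EllipticCurves.Greenberg1999
  Literature.NumberTheory.GaloisCohomology Literature.NumberTheory.GaloisRepresentations
  Summit.BirchSwinnertonDyer.Rank1Residual
  Summit.BirchSwinnertonDyer.Rank1Residual.X1.MuLambda
  Summit.BirchSwinnertonDyer.Rank1Residual.X1.TamagawaSqueeze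
  Summit.BirchSwinnertonDyer.BirchSwinnertonDyer.Theorems.EisensteinPrimesMazurTwinFamily
  Summit.BirchSwinnertonDyer.BirchSwinnertonDyer.Theorems.EisensteinPrimesMazurMCOnCellBTowerRouteT

namespace Summit.BirchSwinnertonDyer.BirchSwinnertonDyer.Theorems.EisensteinPrimesMazurTwinFamilyTowerRouteT

variable {W : WeierstrassCurve ℚ} [W.IsElliptic] [W.IsGloballyMinimal] {p q : ℕ} [hp : Fact p.Prime]

/-! ## §1. Census rows over the raising set of a twin-family pair -/

/-- `p ∣ ℓ^{p−1} − 1` for a prime `p` and `ℓ` prime to `p` (Fermat), so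
`v_p(ℓ^{p−1} − 1) = (v_p(ℓ^{p−1} − 1) − 1) + 1` and `s_ℓ = p^{v_p(ℓ^{p−1} − 1) − 1}`.
[cite: GreenbergVatsal2000, §1 (9)] -/
theorem padicValNat_pow_sub_one_eq_succ {ℓ : ℕ} (hℓ : p.Coprime ℓ) (hℓ1 : 1 < ℓ) :
    padicValNat p (ℓ ^ (p - 1) - 1) = (padicValNat p (ℓ ^ (p - 1) - 1) - 1) + 1 := by
  have hpp : p.Prime := hp.out
  have h1 : 1 ≤ ℓ ^ (p - 1) := Nat.one_le_pow _ _ (by omega)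
  have hdvd : p ∣ ℓ ^ (p - 1) - 1 := by
    have hℓ0 : ((ℓ : ℕ) : ZMod p) ≠ 0 := by
      rw [Ne, ZMod.natCast_eq_zero_iff]
      exact fun h ↦ hpp.ne_one (hℓ.eq_one_of_dvd h)
    have h := ZMod.pow_card_sub_one_eq_one hℓ0
    rw [← ZMod.natCast_eq_zero_iff, Nat.cast_sub h1, Nat.cast_pow, Nat.cast_one, h, sub_self]
  have hne : ℓ ^ (p - 1) - 1 ≠ 0 := by
    have : 2 ≤ ℓ ^ (p - 1) := by
      calc 2 ≤ ℓ := hℓ1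
        _ = ℓ ^ 1 := (pow_one ℓ).symm
        _ ≤ ℓ ^ (p - 1) := Nat.pow_le_pow_right (by omega) (by have := hpp.two_le; omega)
    omega
  have h1le : 1 ≤ padicValNat p (ℓ ^ (p - 1) - 1) := one_le_padicValNat_of_dvd hne hdvd
  omega

/-! ## §2. Route T at the étale end of a twin-family pair, by name -/

section Main

variable {N : ℕ} [NeZero N] {f : CuspForm (Gamma0 N) 2} {ϖ : ℚ} {L : PowerSeries ℚ_[p]}

/-- **Crux 3 at the étale end of a MAZUR TWIN-FAMILY pair from THEOREM B′'s congruence, the TOWER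
budget and the parity datum — census rows read off `MazurTwinFamilyAt`.** `W` globally minimal of
analytic rank `0`, `p ≠ 2` multiplicative, `MazurTwinFamilyAt W p q` (so `p ∣ #E(ℚ)_tors`; (Ram_q)),
`v_p(#E(ℚ)_tors) = 1`; ONE datum `(f, ϖ, L, G)` with THEOREM B's value congruence against
`c·U·∏_{ℓ∈S}(1 − γ_ℓ)`, `S = splitPrimesOutside W p q`, `U ∈ Λˣ`, `c` a unit; the parity datum `#S` odd.
Named PUBLISHED facts: `hWu`, `hpar`, `h415`, `h310`, `hGZK`, and Poitou–Tate / Euler–Poincaré over the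
layers `ℚ_n` (`hPT`, `hEP`, every `n`). Conclusion: `X2.MazurMainConjectureAt W p`. Proof: the places
`v_ℓ` over `ℓ ∈ S` are census Tamagawa rows (`N(v_ℓ) = ℓ`, `m_{v_ℓ} = v_p(ℓ^{p−1} − 1) − 1`,
`c_{v_ℓ} = v_ℓ(Δ_min)` divisible by `p` by (Ram_q)) and at the layer `n = max m_v` the side condition of
`X2.mazurMainConjectureAt_etaleEnd_of_valueCongr_unit_tower` reads `Σ s_ℓ ≤ Σ s_ℓ`.
[cite: Mazur1977, III Cor. (8.5)] [cite: PollackWake2025, Thm. 5.12 (1)] [cite: SilvermanATAEC1994, Cor. IV.9.2(d)]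
[cite: GreenbergLNM1716, Prop. 3.10, Prop. 4.15 (ii), §5 pp. 114–118, p. 137] [cite: Wuthrich2014, Thm. 16 (p. 397)] -/
theorem X2.mazurMainConjectureAt_etaleEnd_twinFamily_of_valueCongr_unit (hp2 : p ≠ 2)
    (hWu : thm16_charIdeal_dvd_multiplicative_of_reducible)
    (hpar : nonempty_modularParametrizationData)
    (h415 : prop415ii_noFiniteSubmodule_of_ordinary_or_multiplicative)
    (h310 : prop310_selmerCorank_mod_two_eq_lambdaInvariant)
    (hGZK : rank_eq_analyticRank_of_analyticRank_le_one)
    (hPT : ∀ (n : ℕ) (κ : ZpExtension ℚ p) [NumberField (κ.layer n)], κ.IsCyclotomic →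
      poitouTate_selmerStructure_duality (κ.layer n))
    (hEP : ∀ (n : ℕ) (κ : ZpExtension ℚ p) [NumberField (κ.layer n)], κ.IsCyclotomic →
      ∀ w : HeightOneSpectrum (𝓞 (κ.layer n)),
      localEulerPoincareCharacteristic (w.adicCompletion (κ.layer n)))
    (hmult : W.HasMultiplicativeReductionAtPrime p) (htw : MazurTwinFamilyAt W p q)
    (hfac : (W.torsionOrder).factorization p = 1) (hr0 : W.analyticRank = 0)
    (hf : IsNewformOf W f) (hϖ : (ϖ : ℝ) * W.realPeriodRat = plusPeriod f)
    (hLs : W.HasSplitMultiplicativeReductionAtPrime p → IsSplitMultPAdicLFunctionOf f p L)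
    (hLn : ¬ W.HasSplitMultiplicativeReductionAtPrime p → IsMultPAdicLFunctionOf f p (-1) L)
    {G : IwasawaAlgebra p} (hG : iwasawaToPowerSeries p G = PowerSeries.C ((ϖ : ℚ) : ℚ_[p]) * L)
    {U : IwasawaAlgebra p} (hU : IsUnit U) {c : ℤ_[p]} (hc : IsUnit c) {n₀ : ℕ}
    (hval : ∀ m : ℕ, n₀ ≤ m → ∀ ζ : ℂ_[p], IsPrimitiveRoot ζ (p ^ (m + 1)) →
      ‖∑' k, ((algebraMap ℚ_[p] ℂ_[p]).comp (algebraMap ℤ_[p] ℚ_[p]))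
          (PowerSeries.coeff k (G - PowerSeries.C c *
            (U * ∏ ℓ ∈ splitPrimesOutside W p q, (1 - frobeniusSeries p ℓ)))) * (ζ - 1) ^ k‖ ≤ (p : ℝ)⁻¹)
    (hSodd : Odd (splitPrimesOutside W p q).card) :
    X2.MazurMainConjectureAt W p := by
  have hpp : p.Prime := hp.out
  set S : Finset ℕ := splitPrimesOutside W p q with hSdef
  have hS : ∀ ℓ ∈ S, p.Coprime ℓ ∧ 1 < ℓ := coprime_and_one_lt_of_mem_splitPrimesOutside hpp
  -- the place over a prime of the raising set
  let plc : S → HeightOneSpectrum (𝓞 ℚ) := fun x ↦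
    (Rat.HeightOneSpectrum.primesEquiv (R := 𝓞 ℚ)).symm ⟨x.1, prime_of_mem_splitPrimesOutside x.2⟩
  have hplc_mem : ∀ x : S, ((x.1 : ℕ) : 𝓞 ℚ) ∈ (plc x).asIdeal := fun x ↦
    (natCast_mem_asIdeal_iff_eq_primesEquiv_symm (plc x) (prime_of_mem_splitPrimesOutside x.2)).mpr rfl
  have hplc_inj : Function.Injective plc := by
    intro x y h
    have h' : (⟨x.1, prime_of_mem_splitPrimesOutside x.2⟩ : Nat.Primes) =
        ⟨y.1, prime_of_mem_splitPrimesOutside y.2⟩ :=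
      (Rat.HeightOneSpectrum.primesEquiv (R := 𝓞 ℚ)).symm.injective h
    have h'' : (x.1 : ℕ) = y.1 := congrArg (Subtype.val : Nat.Primes → ℕ) h'
    exact Subtype.ext h''
  -- census rows
  set S' : Finset (HeightOneSpectrum (𝓞 ℚ)) := S.attach.image plc with hS'def
  let m : HeightOneSpectrum (𝓞 ℚ) → ℕ := fun v ↦ padicValNat p (v.residueCard ^ (p - 1) - 1) - 1
  have hrow : ∀ v ∈ S', ∃ x : S, plc x = v := fun v hv ↦ by
    obtain ⟨x, -, rfl⟩ := Finset.mem_image.mp hv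
    exact ⟨x, rfl⟩
  have hres : ∀ x : S, (plc x).residueCard = x.1 := fun x ↦
    Additive.ZpTower.residueCard_eq_of_prime_mem (prime_of_mem_splitPrimesOutside x.2) (hplc_mem x)
  have hSp : ∀ v ∈ S', ((p : ℕ) : 𝓞 ℚ) ∉ v.asIdeal := by
    intro v hv hpv
    obtain ⟨x, rfl⟩ := hrow v hv
    have h1 := (natCast_mem_asIdeal_iff_eq_primesEquiv_symm (plc x) hpp).mp hpv
    have h2 : (⟨x.1, prime_of_mem_splitPrimesOutside x.2⟩ : Nat.Primes) = ⟨p, hpp⟩ :=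
      (Rat.HeightOneSpectrum.primesEquiv (R := 𝓞 ℚ)).symm.injective h1
    exact (ne_and_ne_of_mem_splitPrimesOutside x.2).1 (congrArg Subtype.val h2)
  have hvalS : ∀ v ∈ S', padicValNat p (v.residueCard ^ (p - 1) - 1) = m v + 1 := by
    intro v hv
    obtain ⟨x, rfl⟩ := hrow v hv
    show padicValNat p ((plc x).residueCard ^ (p - 1) - 1) =
      padicValNat p ((plc x).residueCard ^ (p - 1) - 1) - 1 + 1
    rw [hres x]
    exact padicValNat_pow_sub_one_eq_succ (hS x.1 x.2).1 (hS x.1 x.2).2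
  have hcv : ∀ v ∈ S',
      p ∣ (W.baseChange (v.adicCompletion ℚ)).localTamagawaNumber (v.adicCompletionIntegers ℚ) := by
    intro v hv
    obtain ⟨x, rfl⟩ := hrow v hv
    have hℓ : (x.1 : ℕ).Prime := prime_of_mem_splitPrimesOutside x.2
    haveI : Fact (x.1 : ℕ).Prime := ⟨hℓ⟩
    obtain ⟨hℓN, hsplit⟩ := dvd_and_split_of_mem_splitPrimesOutside x.2
    obtain ⟨hℓ', hsplit'⟩ := hsplit
    have hs : W.HasSplitMultiplicativeReductionAt (plc x) :=
      X2.GreenbergVatsalStrictSelmerMultiplicative.hasSplitMultiplicativeReductionAt_of_mem W x.1 hsplit'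
        (hplc_mem x)
    rw [localTamagawaNumber_eq_ordMinimalDiscriminant_of_hasSplitMultiplicativeReductionAt (plc x) W hs]
    have hv' : ((Rat.HeightOneSpectrum.primesEquiv (plc x) : Nat.Primes) : ℕ) = x.1 :=
      Rat.HeightOneSpectrum.primesEquiv_eq_of_natCast_mem (plc x) hℓ (hplc_mem x)
    rw [LocalTorsionMult.ordMinimalDiscriminant_eq_padicValInt W (plc x) hv']
    have hd : (p : ℤ) ∣ padicValRat x.1 W.Δ :=
      htw.dvd_padicValRat hℓ hℓN (ne_and_ne_of_mem_splitPrimesOutside x.2).1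
        (ne_and_ne_of_mem_splitPrimesOutside x.2).2
    rw [← cast_minimalDiscriminantInt W, padicValRat.of_int] at hd
    exact_mod_cast hd
  -- the layer and the side condition
  set n : ℕ := S'.sup m with hndef
  have hsum : ∑ ℓ ∈ S, sFactor p ℓ ≤ ∑ v ∈ S', p ^ min n (m v) := by
    rw [hS'def, Finset.sum_image (fun x _ y _ h ↦ hplc_inj h), ← Finset.sum_attach S]
    refine Finset.sum_le_sum fun x _ ↦ le_of_eq ?_
    have hle : m (plc x) ≤ n := Finset.le_sup (f := m) (Finset.mem_image_of_mem plc (Finset.mem_attach S x))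
    rw [min_eq_right hle]
    show p ^ (padicValNat p ((x.1 : ℕ) ^ (p - 1) - 1) - 1) =
      p ^ (padicValNat p ((plc x).residueCard ^ (p - 1) - 1) - 1)
    rw [hres x]
  exact X2.mazurMainConjectureAt_etaleEnd_of_valueCongr_unit_tower hp2 hWu hpar h415 h310 hGZK n (hPT n)
    (hEP n) hmult htw.dvd_torsionOrder hfac hr0 S' m hSp hvalS hcv hf hϖ hLs hLn hG hU S hS hc hval
    hSodd hsum

end Main

end Summit.BirchSwinnertonDyer.BirchSwinnertonDyer.Theorems.EisensteinPrimesMazurTwinFamilyTowerRouteT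

end
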